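import Summits.BirchSwinnertonDyer.BirchSwinnertonDyer.Theorems.GenusKolyvaginAtTwoGenusPrimitiveSupplyAtTwoTwistSelmerStrictInherit
import Summits.BirchSwinnertonDyer.BirchSwinnertonDyer.Theorems.CMKolyvaginAtInertTwoImageToolkitAtTwo
import Literature.NumberTheory.EllipticCurves.LocalKummerMap
import Literature.NumberTheory.EllipticCurves.SelmerFiniteProofs
import HarnessLib

/-!
# Route `GenusKolyvaginAtTwo`, crux #2 `GenusPrimitiveSupplyAtTwo` (stmt-BirchSwinnertonDyer-22136):
# Mazur–Rubin Cor. 3.4 (i), STRICT case — the `p`-Selmer group of a congruent / twist partner goes UP by one,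
# GIVEN the parity of the pair (the kernel half of the UP direction; the parity input is displayed, not assumed)

Width seat `bsd-line-gk2-p5` g9 (cell `bsd-f1-sign2`, SUPPLY lineage), file 14 of the series (crux workfile
`Lines/genus-supply-mr-instantiation.md`). THEOREMS ONLY (no definition, no named fact, no `sorry`); helper
`--supports stmt-BirchSwinnertonDyer-22136`; no item is closed; BSD is not proved by any of this.

WHY. The line's consumers of `MazurRubin2010.cor34i_singleton_rat` (gk2-p4 capstones, the lead's row-1 chain, the
SUPPLY″ rows of this lineage) need it in TWO directions at a twisting prime `ℓ` with `#E(K_ℓ)[2] = 2`: NOT strict ⟹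
`#Sel₂` halves (DOWN — a kernel theorem since g8, p620256 / p620693 / lead p622198 §5, modulo Poitou–Tate and Tate's local
Euler characteristic only) and STRICT ⟹ `#Sel₂` doubles (UP). UP is NOT a consequence of duality alone: with `T = {v₀}`,
`t = dim H¹_f(K_{v₀}, E[p]) = 1` and `Sel(E)` strict, Poitou–Tate pins `Sel(E^F)` between `Sel_T = Sel(E)` and `Sel^T` (index
`p`), and the printed conclusion `Sel(E^F) = Sel^T` is Prop. 3.3's parity clause `d ≡ t − dim V_T (mod 2)` — Kramer's
congruence (MR Thm. 2.7; Kramer 1981 Thms 1–2, the sum of the two Cassels pairings), equivalently KMR 2013 Thm. 3.9 for the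
Poonen–Rains quadratic forms. This file proves the KERNEL half of UP with that parity DISPLAYED as a hypothesis on the pair,
in X11b's currency (transport `𝓐 = φ_*𝓚_Y`, sandwich `H¹_{𝓚_S} ≤ H¹_𝓐 ≤ H¹_{𝓚^S}`, one-place Poitou–Tate count):

* §31 `not_isSquare_mul_self_mul_prime` — `n·n·p` is not a square (`p` prime, `n ≠ 0`).
* §32 `natCard_selmerGroup_eq_mul_of_transverse_of_forall_localization_eq_zero` — congruent pair `Y[p] ≅ E[p]` over any
  number field, any prime `p`: agreement off `v₀`, transversality at `v₀`, `t_{v₀} = p`, `Sel(E)` strict at `v₀`, AND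
  `IsSquare (#Sel(Y)·#Sel(E)·[𝓚_{E,v₀} : 𝓐_{v₀} ⊓ 𝓚_{E,v₀}])` (the parity of the pair at `S = {v₀}`) ⟹ `#Sel(Y) = #Sel(E)·p`,
  modulo {PT, Tate χ} (the index-`p` sandwich; `H¹_𝓐 = Sel(E)` would make `#Sel·#Sel·p` a square).
* §33 `apply_eq_self_of_commute_of_forall_addEquiv`, `intertwining_apply_eq_of_hasSurjectiveModNGaloisRep_two` — the
  intertwining map `Wd[2] → W[2]` is UNIQUE when `ρ̄_{W,2}` is onto (`Aut_{Γ_K}(E[2]) = 1`: the commutant is `𝔽₂`, cmk2's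
  `KolyvaginImageTwo.eq_zero_or_eq_id_of_commute_two`, fed with the `3`-cycle and a transposition realised by `Γ_K`). This is
  the hypothesis under which an arbitrary intertwining pair IS the printed identification `E^F[2] = E[2]` (MR Remark 2.4 /
  Kramer §5), i.e. under which the parity fact of the companion Literature file applies to the cell's transported structures.
* §34 `natCard_selmerGroup_twist_eq_mul_two_of_local_of_isSquare` — the twist pair `(E, E^{(d)})` at `p = 2` with the
  lead's / g8's place menu off `v₀` (split ∨ both good `∤ 2` ∨ silent; split ∨ `H¹ = 0` at `∞`), transversality at `v₀`
  displayed (`htr`, = lead's Lemma 2.11 `map_kummerLocalConditionAt_inf_eq_bot_of_twist_ramified`), `#W(K_{v₀})[2] = 2`,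
  strictness, and the parity of the pair ⟹ `#Sel₂(Wd) = #Sel₂(W)·2`.

The parity hypothesis is discharged in the sequel (`…TwistSelmerTransferUpRat.lean`) from the Literature named fact
`MazurRubin2010.kramerParity` (MR10 Thm. 2.7 + Lemma 2.8, statement-only). References: [MazurRubin2010] Def. 3.1, Lemma 3.2,
Prop. 3.3, Cor. 3.4 (i), Thm. 2.7, Lemma 2.8 (arXiv:0904.3709 pp. 6–10); [Kramer1981] Thm. 1, Thm. 2, Prop. 7;
[KlagsbrunMazurRubin2013] Thm. 3.9, Lemmas 5.2/5.4; [MilneADT2006] I Thm. 2.8, Lemma 3.3, Thm. 4.10; [GrossLMS1991] §9.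
-/

set_option linter.dupNamespace false -- tree convention: `Summit.BirchSwinnertonDyer.BirchSwinnertonDyer.Theorems` (summit = sub-problem)
set_option autoImplicit false

noncomputable section

open scoped Classical ContRepresentation

namespace Summit.BirchSwinnertonDyer.BirchSwinnertonDyer.Theorems.GenusKolyTwistLocal

open WeierstrassCurve Field NumberField IsDedekindDomain Function
open Literature.NumberTheory.EllipticCurves Literature.NumberTheory.GaloisRepresentations
open Literature.NumberTheory.GaloisRepresentations.DiscreteGaloisModule (SelmerStructure)
open Literature.NumberTheory.GaloisCohomology
open Summit.BirchSwinnertonDyer.Rank1Residual.X11b.CongruentTransfer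
open Summit.BirchSwinnertonDyer.Rank1Residual.X11b.SelmerCount (card_mul_relIndex_of_le)
open Summit.BirchSwinnertonDyer.Rank1Residual.X11b.KummerPT (kummerStrict kummerRelaxed)

/-! ## §31 Arithmetic: `n · n · p` is never a square -/

section Arith

/-- For a prime `p` and `n ≠ 0`, `n·n·p` is not a perfect square (the `p`-adic valuation is odd). [folklore] -/
theorem not_isSquare_mul_self_mul_prime {p : ℕ} (hp : p.Prime) {n : ℕ} (hn : n ≠ 0) : ¬ IsSquare (n * n * p) := by
  rintro ⟨m, hm⟩
  haveI := Fact.mk hp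
  have hm0 : m ≠ 0 := by
    rintro rfl
    rw [mul_zero] at hm
    exact mul_ne_zero (mul_ne_zero hn hn) hp.ne_zero hm
  have h := congrArg (padicValNat p) hm
  rw [padicValNat.mul (mul_ne_zero hn hn) hp.ne_zero, padicValNat.mul hn hn, padicValNat.mul hm0 hm0,
    padicValNat.self hp.one_lt] at h
  omega

end Arith

/-! ## §32 The UP transfer for a congruent pair with one transverse, STRICT place, given the parity of the pair -/

section Up

variable {K : Type} [Field K] [NumberField K] (W Y : WeierstrassCurve K) [W.IsElliptic] (p : ℕ) [hp : Fact p.Prime]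

/-- **Mazur–Rubin Cor. 3.4 (i), STRICT case, for a congruent pair `Y[p] ≅ E[p]` over a number field `K`, GIVEN the parity
of the pair (`#Sel^{(p)}(Y) = #Sel^{(p)}(E) · p`).** HYPOTHESES: the print facts `poitouTate_selmerStructure_duality_real K`
(Milne ADT I.4.10 with real places) and `localEulerPoincareCharacteristic K_v` (Tate) — exactly as in X11b's one-place count;
inverse `Γ_K`-intertwining maps `φ : Y[p] → E[p]`, `ψ`; the transported Kummer structure `𝓐 = φ_*𝓚_Y` (`h𝓐`); one finite place
`v₀` such that `𝓐` AGREES with `𝓚_E` at every other place, is TRANSVERSE to it at `v₀` (`𝓐_{v₀} ⊓ 𝓚_{E,v₀} = ⊥`),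
`t_{v₀}(E,p) = #E(K_{v₀})[p]·#(𝓞_{v₀}/p) = p`, EVERY class of `Sel^{(p)}(E)` has zero localisation at `v₀` (STRICT), and the
PARITY of the pair at `S = {v₀}`: `#Sel(Y) · #Sel(E) · [𝓚_{E,v₀} : 𝓐_{v₀} ⊓ 𝓚_{E,v₀}]` is a square (Kramer's congruence /
KMR Thm. 3.9 for this pair — displayed, NOT proved here). CONCLUSION: `#Sel^{(p)}(Y/K) = #Sel^{(p)}(E/K) · p`. Proof: index-`p`
sandwiches (`selmerGroup_sandwich_kummer`, `selmerGroup_sandwich_of_agree`, the Poitou–Tate count); strictness gives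
`Sel(E) = H¹_{𝓚_{v₀}}`; transversality gives `[𝓚_{v₀} : 𝓐_{v₀} ⊓ 𝓚_{v₀}] = #𝓚_{v₀} = p` (Milne I 3.3); if `H¹_𝓐` were
`H¹_{𝓚_{v₀}} = Sel(E)` the parity would make `#Sel(E)·#Sel(E)·p` a square; so `H¹_𝓐 = H¹_{𝓚^{v₀}}`, of order `p·#Sel(E)`,
and `#H¹_𝓐 = #Sel(Y)` by transport. [cite: MazurRubin2010, Prop. 3.3 and Cor. 3.4 (i) (arXiv:0904.3709 p. 10)]
[cite: MilneADT2006, Ch. I, Lemma 3.3 and Thm. 4.10] -/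
theorem natCard_selmerGroup_eq_mul_of_transverse_of_forall_localization_eq_zero
    (hPT : poitouTate_selmerStructure_duality_real K)
    (hEP : ∀ v : HeightOneSpectrum (𝓞 K), localEulerPoincareCharacteristic (v.adicCompletion K))
    (φ : (Y.torsionGaloisModule (p : ℤ)).toContRepresentation →ⁱL
      (W.torsionGaloisModule (p : ℤ)).toContRepresentation)
    (ψ : (W.torsionGaloisModule (p : ℤ)).toContRepresentation →ⁱL
      (Y.torsionGaloisModule (p : ℤ)).toContRepresentation)
    (hψφ : ∀ a, ψ (φ a) = a) (hφψ : ∀ b, φ (ψ b) = b)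
    (𝓐 : SelmerStructure (W.torsionGaloisModule (p : ℤ)))
    (h𝓐 : ∀ v, 𝓐 v = (Y.kummerSelmerStructure (p : ℤ) v).map
      (galoisCohomology.map (φ.restrictField (Place.Completion v)) 1))
    (v₀ : HeightOneSpectrum (𝓞 K))
    (hagree : ∀ v : Place K, v ≠ Sum.inr v₀ → 𝓐 v = W.kummerSelmerStructure (p : ℤ) v)
    (htr : 𝓐 (Sum.inr v₀) ⊓ W.kummerSelmerStructure (p : ℤ) (Sum.inr v₀) = ⊥)
    (ht : Nat.card (nsmulAddMonoidHom p : (W.baseChange (v₀.adicCompletion K)).toAffine.Point →+ _).ker *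
        Nat.card (v₀.adicCompletionIntegers K ⧸ Ideal.span {(p : v₀.adicCompletionIntegers K)}) = p)
    (hstrict : ∀ c ∈ (W.kummerSelmerStructure (p : ℤ)).selmerGroup,
      galoisCohomology.localization (W.torsionGaloisModule (p : ℤ)) (Sum.inr v₀) 1 c = 0)
    (hpar : IsSquare (Nat.card (Y.selmerGroup (p : ℤ)) * Nat.card (W.selmerGroup (p : ℤ)) *
      (𝓐 (Sum.inr v₀)).relIndex (W.kummerSelmerStructure (p : ℤ) (Sum.inr v₀)))) :
    Nat.card (Y.selmerGroup (p : ℤ)) = Nat.card (W.selmerGroup (p : ℤ)) * p := by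
  set S : Finset (Place K) := {(Sum.inr v₀ : Place K)} with hS
  have hagreeS : ∀ v ∉ S, 𝓐 v = W.kummerSelmerStructure (p : ℤ) v := fun v hv ↦
    hagree v (by simpa [hS] using hv)
  -- the two sandwiches of index `p`
  obtain ⟨hAlo, hAhi⟩ := selmerGroup_sandwich_of_agree W p S hagreeS
  obtain ⟨hKlo, hKhi⟩ := selmerGroup_sandwich_kummer W p S
  have hidx : (kummerStrict W p S).selmerGroup.relIndex
      (kummerRelaxed W p S).selmerGroup = p := by
    rw [hS, relIndex_kummerStrict_kummerRelaxed_singleton_eq_of_facts W p hPT hEP v₀, ht]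
  -- `Sel(E)` is the strict group (strictness)
  have hK : (W.kummerSelmerStructure (p : ℤ)).selmerGroup = (kummerStrict W p S).selmerGroup := by
    refine le_antisymm (fun c hc ↦ ?_) hKlo
    refine mem_selmerGroup_kummerStrict_of_forall_localization_eq_zero W p S hc fun v hv ↦ ?_
    have hv' : v = Sum.inr v₀ := by simpa [hS] using hv
    subst hv'
    exact hstrict c hc
  -- the local index at `v₀` is `#𝓚_{v₀} = t_{v₀} = p` (transversality + Milne I 3.3)
  have hrel : (𝓐 (Sum.inr v₀)).relIndex (W.kummerSelmerStructure (p : ℤ) (Sum.inr v₀)) = p := by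
    rw [← AddSubgroup.inf_relIndex_right, htr, AddSubgroup.relIndex_bot_left,
      W.natCard_kummerSelmerStructure_inr v₀ hp.out.ne_zero, ht]
  -- transport and finiteness
  have hAY := natCard_selmerGroup_transport_kummer W Y p φ ψ hψφ hφψ 𝓐 h𝓐
  have hSelW : Nat.card (W.selmerGroup (p : ℤ)) = Nat.card (kummerStrict W p S).selmerGroup := by
    rw [selmerGroup_eq_selmerGroup_kummerSelmerStructure, hK]
    rfl
  haveI : Finite (W.selmerGroup (p : ℤ)) := W.finite_selmerGroup_holds (Int.natCast_ne_zero.mpr hp.out.ne_zero)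
  have hn0 : Nat.card (W.selmerGroup (p : ℤ)) ≠ 0 := Nat.card_pos.ne'
  rw [hrel] at hpar
  rcases eq_or_eq_of_le_of_le_of_relIndex_prime hp.out hAlo hAhi hidx with h | h
  · -- `H¹_𝓐 = Sel(E)`: the parity is violated
    exfalso
    rw [← hAY, h, ← hSelW] at hpar
    exact not_isSquare_mul_self_mul_prime hp.out hn0 hpar
  · -- `H¹_𝓐` is the relaxed group, of index `p` over `Sel(E)`
    have hcount := card_mul_relIndex_of_le (hKlo.trans hKhi)
    rw [hidx, ← h, hAY, ← hSelW] at hcount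
    exact hcount.symm

end Up

/-! ## §33 Uniqueness of the intertwining map `Wd[2] → W[2]` when `ρ̄_{W,2}` is onto -/

section Unique

variable {G : Type*} [Group G] {T : Type*} [AddCommGroup T] [DistribMulAction G T]

/-- **An injective `G`-equivariant additive endomorphism of the `4`-group `T` is the identity when `G` realises EVERY additive
automorphism of `T`** (the commutant of the `G`-module `E[2]` is `𝔽₂` for `ρ̄_{E,2}` onto: cmk2's
`KolyvaginImageTwo.eq_zero_or_eq_id_of_commute_two`, fed with the fixed-point-free `3`-cycle of
`KolyvaginImageTwo.exists_smul_three` and the transposition `transport e (shearX 1)`; an injective map is not `0`).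
[cite: GrossLMS1991, §9 (proof of Prop. 9.3)] [cite: LawsonWuthrich2016, Lemma 6] -/
theorem apply_eq_self_of_commute_of_forall_addEquiv (h2 : ∀ t : T, t + t = 0) (hcard : Nat.card T = 4)
    (hsurj : ∀ A : T ≃+ T, ∃ g : G, ∀ t, g • t = A t) (f : T →+ T) (hf0 : ∀ t, f t = 0 → t = 0)
    (hf : ∀ (g : G) (t : T), f (g • t) = g • f t) (t : T) : f t = t := by
  haveI : Fact (Nat.Prime 2) := ⟨Nat.prime_two⟩
  have hT : ∀ t : T, 2 • t = 0 := fun t ↦ by rw [two_nsmul]; exact h2 t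
  have hcard' : Nat.card T = 2 ^ 2 := by rw [hcard]; norm_num
  obtain ⟨e⟩ := KolyvaginImage.nonempty_addEquiv_of_card_eq_sq hT hcard'
  -- squares are realised (everything is)
  have hsq : ∀ A : T ≃+ T, ∃ g : G, ∀ t, g • t = A (A t) := fun A ↦ by
    obtain ⟨g, hg⟩ := hsurj (A.trans A)
    exact ⟨g, fun t ↦ by rw [hg]; rfl⟩
  obtain ⟨z, -, hzfix⟩ := KolyvaginImageTwo.exists_smul_three e hsq
  -- a transposition: `(x, y) ↦ (x + y, y)` fixes `(1, 0)` and moves `(0, 1)`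
  obtain ⟨τ, hτ⟩ := hsurj (KolyvaginImage.transport e (KolyvaginImage.shearX (1 : ZMod 2)))
  set u : T := e.symm ![1, 0] with hu_def
  set w : T := e.symm ![0, 1] with hw_def
  have hshear : KolyvaginImage.shearX (1 : ZMod 2) ![1, 0] = ![1, 0] := by
    ext i; fin_cases i <;> simp
  have hu : τ • u = u := by
    rw [hτ, KolyvaginImage.transport_apply, hu_def, AddEquiv.apply_symm_apply, hshear]
  have hu0 : u ≠ 0 := by
    intro h
    have h' : (![1, 0] : Fin 2 → ZMod 2) = 0 := by
      have := congrArg e h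
      rwa [hu_def, AddEquiv.apply_symm_apply, map_zero] at this
    have h0 := congrFun h' 0
    simp at h0
  have hw : τ • w ≠ w := by
    intro h
    rw [hτ, KolyvaginImage.transport_apply, hw_def, AddEquiv.apply_symm_apply, KolyvaginImage.shearX_apply] at h
    have h' := congrArg e h
    rw [AddEquiv.apply_symm_apply, AddEquiv.apply_symm_apply] at h'
    have h0 := congrFun h' 0
    simp at h0
  rcases KolyvaginImageTwo.eq_zero_or_eq_id_of_commute_two h2 hcard hzfix hu hu0 hw f hf with h | h
  · exact absurd (hf0 u (h u)) hu0
  · exact h t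

variable {K : Type} [Field K] [NumberField K] (W Wd : WeierstrassCurve K) [W.IsElliptic] [Wd.IsElliptic]

omit [Wd.IsElliptic] in
/-- **The intertwining map `Wd[2] → W[2]` is unique when `ρ̄_{W,2}` is onto.** For `W` elliptic over a number field `K` with
`W.HasSurjectiveModNGaloisRep 2` (`Γ_K ↠ Aut W[2] ≅ GL₂(𝔽₂)`), ANY curve `Wd` and ANY inverse pair of continuous
`Γ_K`-intertwining maps `φ : Wd[2] ⇄ W[2] : ψ`, every injective intertwining map `φ' : Wd[2] → W[2]` equals `φ`: the
composite `φ' ∘ ψ` is an injective equivariant endomorphism of `W[2]`, hence the identity (§33). For a model `Wd` of a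
quadratic twist this makes the cell's intertwining pairs (gk2-p5 `exists_intertwining_hsplit`) THE identification
`E^F[2] = E[2]` of the print (Mazur–Rubin 2010 Remark 2.4; Kramer 1981 §5), the hypothesis `huniq` of the Literature fact
`MazurRubin2010.kramerParity`. [cite: GrossLMS1991, §9 (proof of Prop. 9.3)] [cite: MazurRubin2010, §2 (E^F[2] ≅ E[2])] -/
theorem intertwining_apply_eq_of_hasSurjectiveModNGaloisRep_two (hsurj : W.HasSurjectiveModNGaloisRep 2)
    (φ : (Wd.torsionGaloisModule ((2 : ℕ) : ℤ)).toContRepresentation →ⁱL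
      (W.torsionGaloisModule ((2 : ℕ) : ℤ)).toContRepresentation)
    (ψ : (W.torsionGaloisModule ((2 : ℕ) : ℤ)).toContRepresentation →ⁱL
      (Wd.torsionGaloisModule ((2 : ℕ) : ℤ)).toContRepresentation)
    (hψφ : ∀ a, ψ (φ a) = a) (hφψ : ∀ b, φ (ψ b) = b)
    (φ' : (Wd.torsionGaloisModule ((2 : ℕ) : ℤ)).toContRepresentation →ⁱL
      (W.torsionGaloisModule ((2 : ℕ) : ℤ)).toContRepresentation)
    (hφ' : Function.Injective φ') (a : geomTorsion Wd ((2 : ℕ) : ℤ)) : φ' a = φ a := by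
  -- the equivariant endomorphism `f = φ' ∘ ψ` of `W[2]`
  let f : geomTorsion W ((2 : ℕ) : ℤ) →+ geomTorsion W ((2 : ℕ) : ℤ) :=
    { toFun := fun t ↦ φ' (ψ t)
      map_zero' := by rw [map_zero, map_zero]
      map_add' := fun s t ↦ by rw [map_add, map_add] }
  have hf : ∀ (g : absoluteGaloisGroup K) (t : geomTorsion W ((2 : ℕ) : ℤ)), f (g • t) = g • f t := by
    intro g t
    change φ' (ψ (g • t)) = g • φ' (ψ t)
    have h1 : ψ (g • t) = g • ψ t := by
      have := ψ.isIntertwining g t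
      simpa [ContinuousRep.toContRepresentation_apply_apply] using this
    have h2 : φ' (g • ψ t) = g • φ' (ψ t) := by
      have := φ'.isIntertwining g (ψ t)
      simpa [ContinuousRep.toContRepresentation_apply_apply] using this
    rw [h1, h2]
  have hf0 : ∀ t, f t = 0 → t = 0 := by
    intro t ht
    change φ' (ψ t) = 0 at ht
    have h1 : ψ t = 0 := hφ' (by rw [ht, map_zero])
    have := congrArg φ h1
    rwa [hφψ, map_zero] at this
  have h2 : ∀ t : geomTorsion W ((2 : ℕ) : ℤ), t + t = 0 := fun t ↦ by
    have := AddSubgroup.torsionBy.nsmul t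
    rwa [two_nsmul] at this
  have hcard : Nat.card (geomTorsion W ((2 : ℕ) : ℤ)) = 4 := by
    rw [W.natCard_geomTorsion ((2 : ℕ) : ℤ) (by norm_num)]; norm_num
  have hsurj' : W.HasSurjectiveModNGaloisRep ((2 : ℕ) : ℤ) := by simpa using hsurj
  have hreal : ∀ A : geomTorsion W ((2 : ℕ) : ℤ) ≃+ geomTorsion W ((2 : ℕ) : ℤ),
      ∃ g : absoluteGaloisGroup K, ∀ t, g • t = A t := fun A ↦ by
    obtain ⟨g, hg⟩ := hsurj' (Multiplicative.ofAdd A)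
    refine ⟨g, fun t ↦ ?_⟩
    rw [← galoisRepTorsion_apply, hg]
    rfl
  have key := apply_eq_self_of_commute_of_forall_addEquiv h2 hcard hreal f hf0 hf (φ a)
  change φ' (ψ (φ a)) = φ a at key
  rwa [hψφ] at key

end Unique

/-! ## §34 The twist pair `(E, E^{(d)})` at `p = 2`: strict at `v₀` + parity ⟹ `#Sel₂(E^{(d)}) = #Sel₂(E)·2`, from the local rows -/

section Twist

variable {K : Type} [Field K] [NumberField K] (W Wd : WeierstrassCurve K) [W.IsElliptic] [Wd.IsElliptic] (d : K)

/-- **The `2`-Selmer group of a twist partner DOUBLES at a transverse, STRICT place, given the parity of the pair**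
(Mazur–Rubin Cor. 3.4 (i), UP direction, kernel half, assembled). HYPOTHESES: print facts `hPT`, `hEP`; inverse intertwining
`φ, ψ` between `Wd[2]` and `W[2]` with the split-place agreement `hsplit` (`exists_intertwining_hsplit` for a twist model); a
finite `v₀ ∤ 2` with `#W(K_{v₀})[2] = 2`, transversality `htr` of the transported condition of `Wd` to that of `W` at `v₀`
(the lead's Lemma 2.11 `GenusKolyTwistRamified.map_kummerLocalConditionAt_inf_eq_bot_of_twist_ramified` for a ramified twist at a
good odd place) and STRICTNESS of `Sel₂(W)` at `v₀`; the place-by-place menu `hfin` / `hinf` at every other place (split ∨ both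
good `∤ 2` ∨ no rational `2`-torsion `∤ 2`; split ∨ `H¹(K_w, ·) = 0` for both), verbatim as in
`natCard_selmerGroup_twist_mul_two_eq_of_local`; and the PARITY of the pair at `S = {v₀}` for the transported structure
`𝓐 = φ_*𝓚_{Wd}`: `IsSquare (#Sel₂(Wd)·#Sel₂(W)·[𝓚_{W,v₀} : 𝓐_{v₀} ⊓ 𝓚_{W,v₀}])` (Kramer's congruence for this pair — displayed;
discharged from `MazurRubin2010.kramerParity` in the sequel). CONCLUSION: `#Sel₂(Wd) = #Sel₂(W)·2`.
[cite: MazurRubin2010, Thm. 2.7, Prop. 3.3 and Cor. 3.4 (i) (arXiv:0904.3709 pp. 6–10)] [cite: MilneADT2006, Ch. I, Thm. 4.10] -/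
theorem natCard_selmerGroup_twist_eq_mul_two_of_local_of_isSquare
    (hPT : poitouTate_selmerStructure_duality_real K)
    (hEP : ∀ v : HeightOneSpectrum (𝓞 K), localEulerPoincareCharacteristic (v.adicCompletion K))
    (φ : (Wd.torsionGaloisModule ((2 : ℕ) : ℤ)).toContRepresentation →ⁱL
      (W.torsionGaloisModule ((2 : ℕ) : ℤ)).toContRepresentation)
    (ψ : (W.torsionGaloisModule ((2 : ℕ) : ℤ)).toContRepresentation →ⁱL
      (Wd.torsionGaloisModule ((2 : ℕ) : ℤ)).toContRepresentation)
    (hψφ : ∀ a, ψ (φ a) = a) (hφψ : ∀ b, φ (ψ b) = b)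
    (hsplit : ∀ (E : Type) [Field E] [Algebra K E], (∃ s : E, s ^ 2 = algebraMap K E d) →
      (Wd.kummerLocalConditionAt ((2 : ℕ) : ℤ) E).map (galoisCohomology.map (φ.restrictField E) 1) =
        W.kummerLocalConditionAt ((2 : ℕ) : ℤ) E)
    (v₀ : HeightOneSpectrum (𝓞 K)) (hv₀ : ((2 : ℕ) : 𝓞 K) ∉ v₀.asIdeal)
    (hfin : ∀ v : HeightOneSpectrum (𝓞 K), v ≠ v₀ →
      (∃ s : v.adicCompletion K, s ^ 2 = algebraMap K (v.adicCompletion K) d) ∨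
      (((2 : ℕ) : 𝓞 K) ∉ v.asIdeal ∧ W.HasGoodReductionAt v ∧ Wd.HasGoodReductionAt v) ∨
      (((2 : ℕ) : 𝓞 K) ∉ v.asIdeal ∧
        Nat.card (nsmulAddMonoidHom 2 : (W.baseChange (v.adicCompletion K)).toAffine.Point →+ _).ker = 1 ∧
        Nat.card (nsmulAddMonoidHom 2 : (Wd.baseChange (v.adicCompletion K)).toAffine.Point →+ _).ker = 1))
    (hinf : ∀ w : InfinitePlace K,
      (∃ s : w.Completion, s ^ 2 = algebraMap K w.Completion d) ∨
      ((∀ x : galoisCohomology (W.localGaloisModule w.Completion) 1, x = 0) ∧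
        (∀ x : galoisCohomology (Wd.localGaloisModule w.Completion) 1, x = 0)))
    (htr : (Wd.kummerLocalConditionAt ((2 : ℕ) : ℤ) (v₀.adicCompletion K)).map
        (galoisCohomology.map (φ.restrictField (v₀.adicCompletion K)) 1) ⊓
      W.kummerLocalConditionAt ((2 : ℕ) : ℤ) (v₀.adicCompletion K) = ⊥)
    (ht : Nat.card (nsmulAddMonoidHom 2 : (W.baseChange (v₀.adicCompletion K)).toAffine.Point →+ _).ker = 2)
    (hstrict : ∀ c ∈ (W.kummerSelmerStructure ((2 : ℕ) : ℤ)).selmerGroup,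
      galoisCohomology.localization (W.torsionGaloisModule ((2 : ℕ) : ℤ)) (Sum.inr v₀) 1 c = 0)
    (hpar : IsSquare (Nat.card (Wd.selmerGroup ((2 : ℕ) : ℤ)) * Nat.card (W.selmerGroup ((2 : ℕ) : ℤ)) *
      ((Wd.kummerSelmerStructure ((2 : ℕ) : ℤ) (Sum.inr v₀)).map
          (galoisCohomology.map (φ.restrictField (Place.Completion (Sum.inr v₀ : Place K))) 1)).relIndex
        (W.kummerSelmerStructure ((2 : ℕ) : ℤ) (Sum.inr v₀)))) :
    Nat.card (Wd.selmerGroup ((2 : ℕ) : ℤ)) = Nat.card (W.selmerGroup ((2 : ℕ) : ℤ)) * 2 := by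
  -- the transported Kummer structure of `Wd`
  let 𝓐 : SelmerStructure (W.torsionGaloisModule ((2 : ℕ) : ℤ)) := fun v ↦
    (Wd.kummerSelmerStructure ((2 : ℕ) : ℤ) v).map
      (galoisCohomology.map (φ.restrictField (Place.Completion v)) 1)
  have h𝓐 : ∀ v, 𝓐 v = (Wd.kummerSelmerStructure ((2 : ℕ) : ℤ) v).map
      (galoisCohomology.map (φ.restrictField (Place.Completion v)) 1) := fun _ ↦ rfl
  refine natCard_selmerGroup_eq_mul_of_transverse_of_forall_localization_eq_zero W Wd 2 hPT hEP φ ψ hψφ hφψ 𝓐 h𝓐 v₀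
    ?_ ?_ ?_ hstrict ?_
  · -- agreement at every place other than `v₀` (verbatim from `natCard_selmerGroup_twist_mul_two_eq_of_local`)
    rintro (w | v) hv
    · rcases hinf w with ⟨s, hs⟩ | ⟨hW, hWd⟩
      · rw [h𝓐, kummerSelmerStructure_apply, kummerSelmerStructure_apply]
        exact hsplit (Place.Completion (Sum.inl w)) ⟨s, hs⟩
      · rw [h𝓐, kummerSelmerStructure_apply, kummerSelmerStructure_apply]
        exact map_kummerLocalConditionAt_eq_of_eq_top W Wd ((2 : ℕ) : ℤ) (Place.Completion (Sum.inl w)) φ ψ hφψ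
          (kummerLocalConditionAt_eq_top_of_forall_eq_zero Wd _ _ hWd)
          (kummerLocalConditionAt_eq_top_of_forall_eq_zero W _ _ hW)
    · have hvv₀ : v ≠ v₀ := fun h ↦ hv (by rw [h])
      rcases hfin v hvv₀ with ⟨s, hs⟩ | ⟨h2v, hvW, hvWd⟩ | ⟨h2v, h1W, h1Wd⟩
      · rw [h𝓐, kummerSelmerStructure_apply, kummerSelmerStructure_apply]
        exact hsplit (Place.Completion (Sum.inr v)) ⟨s, hs⟩
      · exact transport_kummer_inr_eq_of_good W Wd 2 φ ψ hφψ 𝓐 h𝓐 h2v hvW hvWd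
      · rw [h𝓐, kummerSelmerStructure_apply, kummerSelmerStructure_apply]
        exact map_kummerLocalConditionAt_adicCompletion_eq_of_natCard_ker_eq_one W Wd v two_ne_zero h2v h1W h1Wd φ
  · -- transversality at `v₀`
    rw [h𝓐, kummerSelmerStructure_apply, kummerSelmerStructure_apply]
    exact htr
  · -- `t_{v₀} = 2`
    rw [ht, natCard_quotient_span_natCast_eq_one_of_not_mem v₀ hv₀, mul_one]
  · -- the parity of the pair
    rw [h𝓐]
    exact hpar

end Twist

end Summit.BirchSwinnertonDyer.BirchSwinnertonDyer.Theorems.GenusKolyTwistLocal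

end
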